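import Mathlib.Geometry.Manifold.VectorField.Pullback
import Summits.SmoothPoincare4.SmoothPoincare4.Theorems.CongruenceShadowsAgkCor6SufficiencyStubSeamFlowTube
import Summits.SmoothPoincare4.SmoothPoincare4.Theorems.CongruenceShadowsAgkCor6SufficiencyStubSeamFlowBox

/-!
# Stub `stub_seamFlow` of line `lp-by-sphere-system-surgery` for crux `AgkCor6Sufficiency`, part 2:
# the explicit transverse field in the tube
(item stmt-SmoothPoincare4-10894; lead reshape r5, SF; registered helper stub `stub_seamFlowFieldToolkit`)

The vector field `-(1/2p) ∂_q` of the seam coordinates `(p, q)` of seam `m`, as a smooth vector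
field on the tube: in a corner-slice chart `Θ = (u, v, (Θ∘ρ)₂, (Θ∘ρ)₃)` it is the pull-back
(Mathlib's `VectorField.mpullback`) of the model field `z ↦ -(2 p(z₀, z₁))⁻¹ • (e₁, e₂, 0, 0)`
(`chartField`); its value does not depend on the chart (`chartField_indep`: both are the velocity
of the explicit flow `tubeFlow`, by the chart formula of the tube structure), which defines the
field `tubeField` on the whole tube, smooth where `p ≠ 0` (`contMDiffOn_tubeField`), with the
explicit flow as integral curves (`hasMFDerivAt_tubeFlow_tubeField`) and `dG(ζ) = 1` wherever
`G - 1 = -2 p q` (`mlineDeriv_tubeField_eq_one`).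

References: Milnor, *Lectures on the h-cobordism theorem* (1965), proof of Thm. 3.4 [MilnorHCobordism1965];
Abrams–Gay–Kirby, Geom. Topol. 22 (2018), proof of Thm. 5 [AbramsGayKirby2018].
-/

noncomputable section

set_option linter.dupNamespace false

namespace Summit.SmoothPoincare4.SmoothPoincare4.Cruxes.AgkCor6Sufficiency.LpBySphereSystemSurgery

open Set Function Filter
open scoped _root_.Manifold _root_.ContDiff _root_.Topology
open Literature.Topology.FourManifolds

section Model

/-- The unit `q`-direction of seam `m`, as a vector of `ℝ⁴` (first two = normal coordinates). -/
def dirVec (m : Fin 3) : EuclideanSpace ℝ (Fin 4) := !₂[uOfPQ m 0 1, vOfPQ m 0 1, 0, 0]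

/-- The model field `-(1/2p) ∂_q` in corner-slice coordinates: `z ↦ (-(2 p(z₀, z₁)))⁻¹ • dirVec m`. -/
def seamModelField (m : Fin 3) (z : EuclideanSpace ℝ (Fin 4)) : EuclideanSpace ℝ (Fin 4) :=
  (-(2 * pCo m (z 0) (z 1)))⁻¹ • dirVec m

/-- The model field is smooth off `{p = 0}`. -/
theorem contDiffOn_seamModelField (m : Fin 3) :
    ContDiffOn ℝ ∞ (seamModelField m) {z : EuclideanSpace ℝ (Fin 4) | pCo m (z 0) (z 1) ≠ 0} := by
  have h01 : ContDiff ℝ ∞ fun z : EuclideanSpace ℝ (Fin 4) => (z 0, z 1) := by fun_prop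
  have hp : ContDiff ℝ ∞ fun z : EuclideanSpace ℝ (Fin 4) => pCo m (z 0) (z 1) :=
    (contDiff_pCo m).comp h01
  have key : ContDiffOn ℝ ∞ (fun z : EuclideanSpace ℝ (Fin 4) => (-(2 * pCo m (z 0) (z 1)))⁻¹ • dirVec m)
      {z : EuclideanSpace ℝ (Fin 4) | pCo m (z 0) (z 1) ≠ 0} :=
    (((contDiffOn_const.mul hp.contDiffOn).neg).inv fun z hz => by simpa using hz).smul contDiffOn_const
  exact key

end Model

section Chart

variable {X : Type} [TopologicalSpace X] [ChartedSpace (EuclideanSpace ℝ (Fin 4)) X]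
  {S₀ F : Set X} {u v : X → ℝ} {ρ : X → X} {U O Ot : Set X} {rt : ℝ} {tp : X → ℝ → ℝ → X}
  {m : Fin 3}

/-- The field `-(1/2p) ∂_q` read through the corner-slice chart `C`: the pull-back of the model
field by `C.Θ`. -/
def chartField (m : Fin 3) (C : CornerSliceChart S₀ F u v ρ) (x : X) : TangentSpace (𝓡 4) x :=
  VectorField.mpullback (𝓡 4) 𝓘(ℝ, EuclideanSpace ℝ (Fin 4)) C.Θ
    (fun z => (seamModelField m z : TangentSpace 𝓘(ℝ, EuclideanSpace ℝ (Fin 4)) z)) x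

/-- A corner-slice chart is differentiable with differentiable inverse. -/
theorem mdifferentiable_cornerSlice (C : CornerSliceChart S₀ F u v ρ) :
    C.Θ.MDifferentiable (𝓡 4) 𝓘(ℝ, EuclideanSpace ℝ (Fin 4)) :=
  ⟨C.contMDiffOn_toFun.mdifferentiableOn (by simp), C.contMDiffOn_symm.mdifferentiableOn (by simp)⟩

/-- In the chart, `p` of the chart point is `p` of the point. -/
theorem pCo_chart (C : CornerSliceChart S₀ F u v ρ) {x : X} (hx : x ∈ C.Θ.source) :
    pCo m (C.Θ x 0) (C.Θ x 1) = pCo m (u x) (v x) := by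
  rw [C.apply_zero x hx, C.apply_one x hx]

/-- **Smoothness of the pulled-back field** on `source ∩ {p ≠ 0}` (Mathlib: pull-backs of smooth
fields by local diffeomorphisms are smooth). -/
theorem contMDiffOn_chartField [IsManifold (𝓡 4) ∞ X] (C : CornerSliceChart S₀ F u v ρ) :
    ContMDiffOn (𝓡 4) (𝓡 4).tangent ∞
      (fun x => (⟨x, chartField m C x⟩ : TangentBundle (𝓡 4) X))
      (C.Θ.source ∩ {x | pCo m (u x) (v x) ≠ 0}) := by
  have hmd := mdifferentiable_cornerSlice C
  have hV : ContMDiffOn 𝓘(ℝ, EuclideanSpace ℝ (Fin 4)) 𝓘(ℝ, EuclideanSpace ℝ (Fin 4)).tangent ∞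
      (fun z => (⟨z, seamModelField m z⟩ :
        TangentBundle 𝓘(ℝ, EuclideanSpace ℝ (Fin 4)) (EuclideanSpace ℝ (Fin 4))))
      {z | pCo m (z 0) (z 1) ≠ 0} :=
    contMDiffOn_vectorSpace_iff_contDiffOn.2 (contDiffOn_seamModelField m)
  rintro x ⟨hx, hpx⟩
  have h1 : ContMDiffAt (𝓡 4) 𝓘(ℝ, EuclideanSpace ℝ (Fin 4)) ∞ C.Θ x :=
    (C.contMDiffOn_toFun x hx).contMDiffAt (C.Θ.open_source.mem_nhds hx)
  have h2 : (mfderiv (𝓡 4) 𝓘(ℝ, EuclideanSpace ℝ (Fin 4)) C.Θ x).IsInvertible := ⟨hmd.mfderiv hx, rfl⟩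
  have hxt : C.Θ x ∈ {z : EuclideanSpace ℝ (Fin 4) | pCo m (z 0) (z 1) ≠ 0} := by
    show pCo m (C.Θ x 0) (C.Θ x 1) ≠ 0
    rwa [pCo_chart C hx]
  have key := ContMDiffWithinAt.mpullback_vectorField_preimage (hV _ hxt) h1 h2 (by norm_cast)
  refine (key.mono ?_ : _)
  rintro y ⟨hy, hpy⟩
  show pCo m (C.Θ y 0) (C.Θ y 1) ≠ 0
  rwa [pCo_chart C hy]

/-- **The pulled-back field, written with the inverse chart**:
`chartField m C x = dΘ⁻¹_{Θ x} (model field at Θ x)`. -/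
theorem chartField_eq (C : CornerSliceChart S₀ F u v ρ) {x : X} (hx : x ∈ C.Θ.source) :
    chartField m C x = mfderiv 𝓘(ℝ, EuclideanSpace ℝ (Fin 4)) (𝓡 4) C.Θ.symm (C.Θ x)
      (seamModelField m (C.Θ x)) := by
  have hmd := mdifferentiable_cornerSlice C
  unfold chartField
  rw [VectorField.mpullback_apply]
  have : mfderiv (𝓡 4) 𝓘(ℝ, EuclideanSpace ℝ (Fin 4)) C.Θ x =
      ((hmd.mfderiv hx : TangentSpace (𝓡 4) x ≃L[ℝ] TangentSpace 𝓘(ℝ, EuclideanSpace ℝ (Fin 4)) (C.Θ x)) :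
        TangentSpace (𝓡 4) x →L[ℝ] TangentSpace 𝓘(ℝ, EuclideanSpace ℝ (Fin 4)) (C.Θ x)) := rfl
  rw [this, ContinuousLinearMap.inverse_equiv]
  rfl

/-- A tube point over `W` lies in the source of the chart (it is `Θ⁻¹` of its slice vector). -/
theorem mem_source_of_formula (hTS : TubeStructure S₀ F u v ρ O Ot rt tp) (hfr : NormalFrame F u v ρ U O)
    {C : CornerSliceChart S₀ F u v ρ} {W : Set X}
    (hCW : ∀ p' ∈ W, p' ∈ F → ∀ a b : ℝ, a ^ 2 + b ^ 2 < rt ^ 2 →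
      (!₂[a, b, C.Θ p' 2, C.Θ p' 3] : EuclideanSpace ℝ (Fin 4)) ∈ C.Θ.target ∧
      tp p' a b = C.Θ.symm (!₂[a, b, C.Θ p' 2, C.Θ p' 3]))
    {x : X} (hx : x ∈ Ot) (hW : ρ x ∈ W) : x ∈ C.Θ.source := by
  obtain ⟨h1, h2⟩ := hCW _ hW (hfr.ρ_mem x (hTS.subset_O hx)) _ _ (hTS.sq_lt x hx)
  rw [hTS.tp_self x hx] at h2
  rw [h2]
  exact C.Θ.map_target h1

/-- The disc condition of the explicit flow at time `0`. -/
theorem disc_zero (hTS : TubeStructure S₀ F u v ρ O Ot rt tp) {x : X} (hx : x ∈ Ot) :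
    uOfPQ m (pCo m (u x) (v x)) (qCo m (u x) (v x) - 0 / (2 * pCo m (u x) (v x))) ^ 2 +
      vOfPQ m (pCo m (u x) (v x)) (qCo m (u x) (v x) - 0 / (2 * pCo m (u x) (v x))) ^ 2 < rt ^ 2 := by
  rw [zero_div, sub_zero, uOfPQ_pCo_qCo, vOfPQ_pCo_qCo]
  exact hTS.sq_lt x hx

omit [TopologicalSpace X] [ChartedSpace (EuclideanSpace ℝ (Fin 4)) X] in
/-- The disc condition is an open condition in time. -/
theorem isOpen_disc (m : Fin 3) (u v : X → ℝ) (x : X) (rt : ℝ) :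
    IsOpen {s : ℝ | uOfPQ m (pCo m (u x) (v x)) (qCo m (u x) (v x) - s / (2 * pCo m (u x) (v x))) ^ 2 +
      vOfPQ m (pCo m (u x) (v x)) (qCo m (u x) (v x) - s / (2 * pCo m (u x) (v x))) ^ 2 < rt ^ 2} := by
  have hc : Continuous fun s : ℝ => (pCo m (u x) (v x), qCo m (u x) (v x) - s / (2 * pCo m (u x) (v x))) :=
    by fun_prop
  exact isOpen_lt ((((contDiff_uOfPQ m).continuous.comp hc).pow 2).add
    (((contDiff_vOfPQ m).continuous.comp hc).pow 2)) continuous_const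

/-- **The explicit flow is an integral curve of the pulled-back field** (in a chart over `W ∋ ρ x`
where the chart formula holds): `d/dt tubeFlow x = chartField (tubeFlow x t)`, the curve being
`Θ⁻¹` of an affine line of slice vectors. -/
theorem hasMFDerivAt_tubeFlow_chartField (hTS : TubeStructure S₀ F u v ρ O Ot rt tp)
    (hfr : NormalFrame F u v ρ U O) {C : CornerSliceChart S₀ F u v ρ} {W : Set X}
    (hCW : ∀ p' ∈ W, p' ∈ F → ∀ a b : ℝ, a ^ 2 + b ^ 2 < rt ^ 2 →
      (!₂[a, b, C.Θ p' 2, C.Θ p' 3] : EuclideanSpace ℝ (Fin 4)) ∈ C.Θ.target ∧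
      tp p' a b = C.Θ.symm (!₂[a, b, C.Θ p' 2, C.Θ p' 3]))
    {x : X} (hx : x ∈ Ot) (hW : ρ x ∈ W) {t : ℝ}
    (hd : uOfPQ m (pCo m (u x) (v x)) (qCo m (u x) (v x) - t / (2 * pCo m (u x) (v x))) ^ 2 +
      vOfPQ m (pCo m (u x) (v x)) (qCo m (u x) (v x) - t / (2 * pCo m (u x) (v x))) ^ 2 < rt ^ 2) :
    HasMFDerivAt 𝓘(ℝ, ℝ) (𝓡 4) (tubeFlow m u v ρ tp x) t
      ((1 : ℝ →L[ℝ] ℝ).smulRight (chartField m C (tubeFlow m u v ρ tp x t))) := by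
  have hmd := mdifferentiable_cornerSlice C
  have hρF : ρ x ∈ F := hfr.ρ_mem x (hTS.subset_O hx)
  set P : ℝ := pCo m (u x) (v x) with hP
  set Q : ℝ := qCo m (u x) (v x) with hQ
  -- the affine line of slice vectors
  set base : EuclideanSpace ℝ (Fin 4) := !₂[u x, v x, C.Θ (ρ x) 2, C.Θ (ρ x) 3] with hbase
  set w : EuclideanSpace ℝ (Fin 4) := (-(2 * P))⁻¹ • dirVec m with hw
  set c : ℝ → EuclideanSpace ℝ (Fin 4) := fun s => base + s • w with hc
  have hcs : ∀ s : ℝ, c s = !₂[uOfPQ m P (Q - s / (2 * P)), vOfPQ m P (Q - s / (2 * P)),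
      C.Θ (ρ x) 2, C.Θ (ρ x) 3] := by
    intro s
    rw [(tubeFlow_coords m u v x s).1, (tubeFlow_coords m u v x s).2]
    ext i
    fin_cases i <;> simp [hc, hbase, hw, dirVec] <;> ring
  -- near `t` the curve is `Θ⁻¹ ∘ c`
  have hev : ∀ᶠ s in 𝓝 t, uOfPQ m P (Q - s / (2 * P)) ^ 2 + vOfPQ m P (Q - s / (2 * P)) ^ 2 < rt ^ 2 :=
    (isOpen_disc m u v x rt).mem_nhds hd
  have hformula : ∀ s : ℝ, uOfPQ m P (Q - s / (2 * P)) ^ 2 + vOfPQ m P (Q - s / (2 * P)) ^ 2 < rt ^ 2 →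
      c s ∈ C.Θ.target ∧ tubeFlow m u v ρ tp x s = C.Θ.symm (c s) := by
    intro s hs
    obtain ⟨h1, h2⟩ := hCW _ hW hρF _ _ hs
    rw [hcs s]
    exact ⟨h1, h2⟩
  have heq : tubeFlow m u v ρ tp x =ᶠ[𝓝 t] (C.Θ.symm ∘ c) := by
    filter_upwards [hev] with s hs
    exact (hformula s hs).2
  -- derivatives
  have hc' : HasMFDerivAt 𝓘(ℝ, ℝ) 𝓘(ℝ, EuclideanSpace ℝ (Fin 4)) c t ((1 : ℝ →L[ℝ] ℝ).smulRight w) := by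
    have h1 : HasDerivAt c w t := by
      have := ((hasDerivAt_id t).smul_const w).const_add base
      simpa [hc] using this
    exact hasMFDerivAt_iff_hasFDerivAt.2 h1.hasFDerivAt
  have hct : c t ∈ C.Θ.target := (hformula t hd).1
  have hΘ : HasMFDerivAt 𝓘(ℝ, EuclideanSpace ℝ (Fin 4)) (𝓡 4) C.Θ.symm (c t)
      (mfderiv 𝓘(ℝ, EuclideanSpace ℝ (Fin 4)) (𝓡 4) C.Θ.symm (c t)) :=
    (hmd.symm.mdifferentiableAt hct).hasMFDerivAt
  have hcomp := hΘ.comp t hc'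
  have hy : tubeFlow m u v ρ tp x t = C.Θ.symm (c t) := (hformula t hd).2
  have hysrc : C.Θ.symm (c t) ∈ C.Θ.source := C.Θ.map_target hct
  -- the value of the model field at `c t` is `w`
  have e0 : c t 0 = uOfPQ m P (Q - t / (2 * P)) := by rw [hcs t]; rfl
  have e1 : c t 1 = vOfPQ m P (Q - t / (2 * P)) := by rw [hcs t]; rfl
  have hVct : seamModelField m (c t) = w := by
    rw [seamModelField, e0, e1, pCo_uOfPQ_vOfPQ]
  have hval : (mfderiv 𝓘(ℝ, EuclideanSpace ℝ (Fin 4)) (𝓡 4) C.Θ.symm (c t)).comp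
      ((1 : ℝ →L[ℝ] ℝ).smulRight w) =
      (1 : ℝ →L[ℝ] ℝ).smulRight (chartField m C (C.Θ.symm (c t))) := by
    apply ContinuousLinearMap.ext_ring
    show mfderiv 𝓘(ℝ, EuclideanSpace ℝ (Fin 4)) (𝓡 4) C.Θ.symm (c t) (((1 : ℝ →L[ℝ] ℝ) (1 : ℝ)) • w) =
      ((1 : ℝ →L[ℝ] ℝ) (1 : ℝ)) • chartField m C (C.Θ.symm (c t))
    rw [chartField_eq C hysrc, C.Θ.right_inv hct, hVct]
    simp
  rw [hy]
  exact (hcomp.congr_mfderiv hval).congr_of_eventuallyEq heq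

/-- **Chart independence**: two corner-slice charts whose chart formulas hold over `ρ x` give the
same field at `x` (both are the velocity of the explicit flow at time `0`; no hypothesis `p ≠ 0` is needed, both
sides being `0` by the junk conventions when `p = 0`). -/
theorem chartField_indep (hTS : TubeStructure S₀ F u v ρ O Ot rt tp) (hfr : NormalFrame F u v ρ U O)
    {C C' : CornerSliceChart S₀ F u v ρ} {W W' : Set X}
    (hCW : ∀ p' ∈ W, p' ∈ F → ∀ a b : ℝ, a ^ 2 + b ^ 2 < rt ^ 2 →
      (!₂[a, b, C.Θ p' 2, C.Θ p' 3] : EuclideanSpace ℝ (Fin 4)) ∈ C.Θ.target ∧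
      tp p' a b = C.Θ.symm (!₂[a, b, C.Θ p' 2, C.Θ p' 3]))
    (hCW' : ∀ p' ∈ W', p' ∈ F → ∀ a b : ℝ, a ^ 2 + b ^ 2 < rt ^ 2 →
      (!₂[a, b, C'.Θ p' 2, C'.Θ p' 3] : EuclideanSpace ℝ (Fin 4)) ∈ C'.Θ.target ∧
      tp p' a b = C'.Θ.symm (!₂[a, b, C'.Θ p' 2, C'.Θ p' 3]))
    {x : X} (hx : x ∈ Ot) (hW : ρ x ∈ W) (hW' : ρ x ∈ W') :
    chartField m C x = chartField m C' x := by
  have h1 := (hasMFDerivAt_tubeFlow_chartField (m := m) hTS hfr hCW hx hW (disc_zero hTS hx)).mfderiv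
  have h2 := (hasMFDerivAt_tubeFlow_chartField (m := m) hTS hfr hCW' hx hW' (disc_zero hTS hx)).mfderiv
  rw [h1] at h2
  have h3 := congrArg (fun f : ℝ →L[ℝ] TangentSpace (𝓡 4) (tubeFlow m u v ρ tp x 0) => f 1) h2
  have h4 : chartField m C (tubeFlow m u v ρ tp x 0) = chartField m C' (tubeFlow m u v ρ tp x 0) := by
    simpa using h3
  rwa [tubeFlow_zero hTS hx] at h4

end Chart

section Global

variable {X : Type} [TopologicalSpace X] [ChartedSpace (EuclideanSpace ℝ (Fin 4)) X]
  {S₀ F : Set X} {u v : X → ℝ} {ρ : X → X} {U O Ot : Set X} {rt : ℝ} {tp : X → ℝ → ℝ → X}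
  {m : Fin 3}

open Classical in
/-- **The transverse field of seam `m` on the tube**: the pulled-back model field in the chosen
corner-slice chart `C (ρ x)` at the foot point (`0` off `ρ⁻¹ F`). -/
def tubeField (m : Fin 3) (ρ : X → X) (C : ∀ p : X, p ∈ F → CornerSliceChart S₀ F u v ρ) (x : X) :
    TangentSpace (𝓡 4) x :=
  if h : ρ x ∈ F then chartField m (C (ρ x) h) x else 0

/-- **Chosen corner-slice charts with the chart formula** (from `TubeStructure.chart`). -/
theorem exists_chartChoice (hTS : TubeStructure S₀ F u v ρ O Ot rt tp) :
    ∃ (C : ∀ p : X, p ∈ F → CornerSliceChart S₀ F u v ρ) (W : ∀ p : X, p ∈ F → Set X),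
      ∀ p (hp : p ∈ F), IsOpen (W p hp) ∧ p ∈ W p hp ∧
        ∀ p' ∈ W p hp, p' ∈ F → ∀ a b : ℝ, a ^ 2 + b ^ 2 < rt ^ 2 →
          (!₂[a, b, (C p hp).Θ p' 2, (C p hp).Θ p' 3] : EuclideanSpace ℝ (Fin 4)) ∈ (C p hp).Θ.target ∧
          tp p' a b = (C p hp).Θ.symm (!₂[a, b, (C p hp).Θ p' 2, (C p hp).Θ p' 3]) := by
  choose C W hWo hpW _ _ hCW using hTS.chart
  exact ⟨C, W, fun p hp => ⟨hWo p hp, hpW p hp, hCW p hp⟩⟩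

variable {C : ∀ p : X, p ∈ F → CornerSliceChart S₀ F u v ρ} {W : ∀ p : X, p ∈ F → Set X}

/-- On the tube, `tubeField` is the chart field of the chosen chart at the foot point. -/
theorem tubeField_of_mem (hTS : TubeStructure S₀ F u v ρ O Ot rt tp) (hfr : NormalFrame F u v ρ U O)
    {x : X} (hx : x ∈ Ot) :
    tubeField m ρ C x = chartField m (C (ρ x) (hfr.ρ_mem x (hTS.subset_O hx))) x := by
  unfold tubeField
  rw [dif_pos (hfr.ρ_mem x (hTS.subset_O hx))]

/-- `tubeField` agrees with the chart field of ANY chosen chart whose set `W` contains `ρ x`. -/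
theorem tubeField_eq_chartField (hTS : TubeStructure S₀ F u v ρ O Ot rt tp) (hfr : NormalFrame F u v ρ U O)
    (hCW : ∀ p (hp : p ∈ F), IsOpen (W p hp) ∧ p ∈ W p hp ∧
      ∀ p' ∈ W p hp, p' ∈ F → ∀ a b : ℝ, a ^ 2 + b ^ 2 < rt ^ 2 →
        (!₂[a, b, (C p hp).Θ p' 2, (C p hp).Θ p' 3] : EuclideanSpace ℝ (Fin 4)) ∈ (C p hp).Θ.target ∧
        tp p' a b = (C p hp).Θ.symm (!₂[a, b, (C p hp).Θ p' 2, (C p hp).Θ p' 3]))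
    {x : X} (hx : x ∈ Ot) {p₀ : X} (hp₀ : p₀ ∈ F) (hW₀ : ρ x ∈ W p₀ hp₀) :
    tubeField m ρ C x = chartField m (C p₀ hp₀) x := by
  rw [tubeField_of_mem hTS hfr hx]
  exact chartField_indep hTS hfr (hCW _ _).2.2 (hCW _ _).2.2 hx (hCW _ _).2.1 hW₀

/-- **Smoothness of the tube field** on `{x ∈ Ot | p x ≠ 0}`. -/
theorem contMDiffOn_tubeField [IsManifold (𝓡 4) ∞ X] (hTS : TubeStructure S₀ F u v ρ O Ot rt tp) (hfr : NormalFrame F u v ρ U O)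
    (hCW : ∀ p (hp : p ∈ F), IsOpen (W p hp) ∧ p ∈ W p hp ∧
      ∀ p' ∈ W p hp, p' ∈ F → ∀ a b : ℝ, a ^ 2 + b ^ 2 < rt ^ 2 →
        (!₂[a, b, (C p hp).Θ p' 2, (C p hp).Θ p' 3] : EuclideanSpace ℝ (Fin 4)) ∈ (C p hp).Θ.target ∧
        tp p' a b = (C p hp).Θ.symm (!₂[a, b, (C p hp).Θ p' 2, (C p hp).Θ p' 3])) :
    ContMDiffOn (𝓡 4) (𝓡 4).tangent ∞
      (fun x => (⟨x, tubeField m ρ C x⟩ : TangentBundle (𝓡 4) X))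
      {x | x ∈ Ot ∧ pCo m (u x) (v x) ≠ 0} := by
  rintro x₀ ⟨hx₀, hp₀⟩
  have hρ₀ : ρ x₀ ∈ F := hfr.ρ_mem x₀ (hTS.subset_O hx₀)
  obtain ⟨hWo, hpW, hform⟩ := hCW (ρ x₀) hρ₀
  set C₀ := C (ρ x₀) hρ₀ with hC₀
  -- the neighbourhood on which `tubeField = chartField C₀`
  set Un : Set X := {x | x ∈ Ot ∧ pCo m (u x) (v x) ≠ 0} ∩ ρ ⁻¹' W (ρ x₀) hρ₀ with hUn
  have hPc : Continuous fun x => pCo m (u x) (v x) :=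
    (contDiff_pCo m).continuous.comp (hfr.contMDiff_u.continuous.prodMk hfr.contMDiff_v.continuous)
  have hUo : IsOpen Un :=
    (hTS.isOpen.inter (isOpen_ne_fun hPc continuous_const)).inter (hWo.preimage hfr.contMDiff_ρ.continuous)
  have hx₀U : x₀ ∈ Un := ⟨⟨hx₀, hp₀⟩, hpW⟩
  have heq : ∀ x ∈ Un, (⟨x, tubeField m ρ C x⟩ : TangentBundle (𝓡 4) X) = ⟨x, chartField m C₀ x⟩ := by
    rintro x ⟨⟨hx, -⟩, hxW⟩
    rw [tubeField_eq_chartField hTS hfr hCW hx hρ₀ hxW]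
  have hsm : ContMDiffAt (𝓡 4) (𝓡 4).tangent ∞
      (fun x => (⟨x, chartField m C₀ x⟩ : TangentBundle (𝓡 4) X)) x₀ := by
    have hsrc : x₀ ∈ C₀.Θ.source := mem_source_of_formula hTS hfr hform hx₀ hpW
    exact (contMDiffOn_chartField C₀ x₀ ⟨hsrc, hp₀⟩).contMDiffAt
      ((C₀.Θ.open_source.inter (isOpen_ne_fun hPc continuous_const)).mem_nhds ⟨hsrc, hp₀⟩)
  have hev : (fun x => (⟨x, tubeField m ρ C x⟩ : TangentBundle (𝓡 4) X)) =ᶠ[𝓝 x₀]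
      fun x => ⟨x, chartField m C₀ x⟩ := by
    filter_upwards [hUo.mem_nhds hx₀U] with x hx
    exact heq x hx
  exact (hsm.congr_of_eventuallyEq hev).contMDiffWithinAt

/-- **The explicit flow is an integral curve of the tube field** while in range. -/
theorem hasMFDerivAt_tubeFlow_tubeField (hTS : TubeStructure S₀ F u v ρ O Ot rt tp)
    (hfr : NormalFrame F u v ρ U O)
    (hCW : ∀ p (hp : p ∈ F), IsOpen (W p hp) ∧ p ∈ W p hp ∧
      ∀ p' ∈ W p hp, p' ∈ F → ∀ a b : ℝ, a ^ 2 + b ^ 2 < rt ^ 2 →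
        (!₂[a, b, (C p hp).Θ p' 2, (C p hp).Θ p' 3] : EuclideanSpace ℝ (Fin 4)) ∈ (C p hp).Θ.target ∧
        tp p' a b = (C p hp).Θ.symm (!₂[a, b, (C p hp).Θ p' 2, (C p hp).Θ p' 3]))
    {x : X} (hx : x ∈ Ot) {t : ℝ}
    (hd : uOfPQ m (pCo m (u x) (v x)) (qCo m (u x) (v x) - t / (2 * pCo m (u x) (v x))) ^ 2 +
      vOfPQ m (pCo m (u x) (v x)) (qCo m (u x) (v x) - t / (2 * pCo m (u x) (v x))) ^ 2 < rt ^ 2) :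
    HasMFDerivAt 𝓘(ℝ, ℝ) (𝓡 4) (tubeFlow m u v ρ tp x) t
      ((1 : ℝ →L[ℝ] ℝ).smulRight (tubeField m ρ C (tubeFlow m u v ρ tp x t))) := by
  have hρF : ρ x ∈ F := hfr.ρ_mem x (hTS.subset_O hx)
  obtain ⟨hy, hρy, -⟩ := tubeFlow_spec hTS hfr hx hd
  have hWy : ρ (tubeFlow m u v ρ tp x t) ∈ W (ρ x) hρF := by rw [hρy]; exact (hCW _ _).2.1
  rw [tubeField_eq_chartField hTS hfr hCW hy hρF hWy]
  exact hasMFDerivAt_tubeFlow_chartField hTS hfr (hCW _ hρF).2.2 hx (hCW _ _).2.1 hd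

/-- **The tube field moves `G` at unit speed where `G - 1 = -2 p q`**: on an open `B ⊆ Ot` on which
`G - 1 = -2 p q`, `dG(tubeField) = 1`. -/
theorem mlineDeriv_tubeField_eq_one (hTS : TubeStructure S₀ F u v ρ O Ot rt tp)
    (hfr : NormalFrame F u v ρ U O)
    (hCW : ∀ p (hp : p ∈ F), IsOpen (W p hp) ∧ p ∈ W p hp ∧
      ∀ p' ∈ W p hp, p' ∈ F → ∀ a b : ℝ, a ^ 2 + b ^ 2 < rt ^ 2 →
        (!₂[a, b, (C p hp).Θ p' 2, (C p hp).Θ p' 3] : EuclideanSpace ℝ (Fin 4)) ∈ (C p hp).Θ.target ∧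
        tp p' a b = (C p hp).Θ.symm (!₂[a, b, (C p hp).Θ p' 2, (C p hp).Θ p' 3]))
    {G : X → ℝ} (hG : ContMDiff (𝓡 4) 𝓘(ℝ, ℝ) ∞ G) {B : Set X} (hB : IsOpen B) (hBOt : B ⊆ Ot)
    (hGB : ∀ y ∈ B, G y - 1 = -2 * pCo m (u y) (v y) * qCo m (u y) (v y)) {x : X} (hx : x ∈ B)
    (hp : pCo m (u x) (v x) ≠ 0) : mlineDeriv (𝓡 4) G x (tubeField m ρ C x) = 1 := by
  have hxOt : x ∈ Ot := hBOt hx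
  have h := hasMFDerivAt_tubeFlow_tubeField (m := m) hTS hfr hCW hxOt (disc_zero hTS hxOt)
  have hD := hasDerivAt_comp_of_hasMFDerivAt hG h
  -- along the curve, `G = G x + s` for small `s`
  have hcont : ContinuousAt (tubeFlow m u v ρ tp x) 0 := h.continuousAt
  have h0 : tubeFlow m u v ρ tp x 0 = x := tubeFlow_zero hTS hxOt
  have hevB : ∀ᶠ s in 𝓝 (0 : ℝ), tubeFlow m u v ρ tp x s ∈ B :=
    hcont.preimage_mem_nhds (by rw [h0]; exact hB.mem_nhds hx)
  have hevD : ∀ᶠ s in 𝓝 (0 : ℝ), uOfPQ m (pCo m (u x) (v x)) (qCo m (u x) (v x) - s / (2 * pCo m (u x) (v x))) ^ 2 +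
      vOfPQ m (pCo m (u x) (v x)) (qCo m (u x) (v x) - s / (2 * pCo m (u x) (v x))) ^ 2 < rt ^ 2 :=
    (isOpen_disc m u v x rt).mem_nhds (disc_zero hTS hxOt)
  have hlin : (G ∘ tubeFlow m u v ρ tp x) =ᶠ[𝓝 0] fun s => G x + s := by
    filter_upwards [hevB, hevD] with s hsB hsD
    obtain ⟨-, -, -, -, hps, hqs⟩ := tubeFlow_spec hTS hfr hxOt hsD
    have e1 := hGB _ hsB
    rw [hps, hqs, sigma_model _ _ _ hp, ← hGB x hx] at e1
    show G (tubeFlow m u v ρ tp x s) = G x + s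
    linarith
  have hD1 : HasDerivAt (G ∘ tubeFlow m u v ρ tp x) 1 0 := by
    have : HasDerivAt (fun s : ℝ => G x + s) 1 0 := (hasDerivAt_id (0 : ℝ)).const_add (G x)
    exact this.congr_of_eventuallyEq hlin
  have := hD.unique hD1
  rwa [h0] at this

end Global

/-- **The field toolkit** (registered helper stub `stub_seamFlowFieldToolkit` of `stub_seamFlow`):
for a tube structure of a normal frame there is a choice of corner-slice charts with the chart
formula such that the tube field `tubeField m ρ C` is smooth on `{x ∈ Ot | p ≠ 0}`, has the explicit
seam flow as integral curves (while in range), and has `dG(ζ) = 1` on any open part of the tube on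
which `G - 1 = -2 p q` (at points with `p ≠ 0`). -/
def SeamFlowFieldToolkit : Prop :=
  ∀ (X : Type) [TopologicalSpace X] [ChartedSpace (EuclideanSpace ℝ (Fin 4)) X] [IsManifold (𝓡 4) ∞ X]
    (S₀ F : Set X) (u v : X → ℝ) (ρ : X → X) (U O Ot : Set X) (rt : ℝ) (tp : X → ℝ → ℝ → X)
    (m : Fin 3), TubeStructure S₀ F u v ρ O Ot rt tp → NormalFrame F u v ρ U O →
    ∃ C : ∀ p : X, p ∈ F → CornerSliceChart S₀ F u v ρ,
      ContMDiffOn (𝓡 4) (𝓡 4).tangent ∞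
        (fun x => (⟨x, tubeField m ρ C x⟩ : TangentBundle (𝓡 4) X)) {x | x ∈ Ot ∧ pCo m (u x) (v x) ≠ 0} ∧
      (∀ x ∈ Ot, ∀ t : ℝ,
        uOfPQ m (pCo m (u x) (v x)) (qCo m (u x) (v x) - t / (2 * pCo m (u x) (v x))) ^ 2 +
          vOfPQ m (pCo m (u x) (v x)) (qCo m (u x) (v x) - t / (2 * pCo m (u x) (v x))) ^ 2 < rt ^ 2 →
        HasMFDerivAt 𝓘(ℝ, ℝ) (𝓡 4) (tubeFlow m u v ρ tp x) t
          ((1 : ℝ →L[ℝ] ℝ).smulRight (tubeField m ρ C (tubeFlow m u v ρ tp x t)))) ∧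
      (∀ (G : X → ℝ), ContMDiff (𝓡 4) 𝓘(ℝ, ℝ) ∞ G → ∀ B : Set X, IsOpen B → B ⊆ Ot →
        (∀ y ∈ B, G y - 1 = -2 * pCo m (u y) (v y) * qCo m (u y) (v y)) →
        ∀ x ∈ B, pCo m (u x) (v x) ≠ 0 → mlineDeriv (𝓡 4) G x (tubeField m ρ C x) = 1)

/-- **Registered helper stub `stub_seamFlowFieldToolkit`.** -/
theorem stub_seamFlowFieldToolkit : SeamFlowFieldToolkit := by
  intro X _ _ _ S₀ F u v ρ U O Ot rt tp m hTS hfr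
  obtain ⟨C, W, hCW⟩ := exists_chartChoice hTS
  exact ⟨C, contMDiffOn_tubeField hTS hfr hCW, fun x hx t hd => hasMFDerivAt_tubeFlow_tubeField hTS hfr hCW hx hd,
    fun G hG B hB hBOt hGB x hx hp => mlineDeriv_tubeField_eq_one hTS hfr hCW hG hB hBOt hGB hx hp⟩

end Summit.SmoothPoincare4.SmoothPoincare4.Cruxes.AgkCor6Sufficiency.LpBySphereSystemSurgery

end
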